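import Literature.MathematicalPhysics.QuantumLattice.TorusMarkovPressureBound
import Literature.MathematicalPhysics.QuantumLattice.HubbardNNNHoppingInteractionTorus
import Literature.MathematicalPhysics.QuantumLattice.HubbardNNNHoppingWindowCertificate
import Literature.MathematicalPhysics.QuantumLattice.FermionTorusTranslationSums
import Literature.MathematicalPhysics.QuantumLattice.HubbardAtomicLimit
import HarnessLib

/-!
# The certified Markov upper bound on the grand-canonical pressure of the `t–t'` Hubbard torus

Topic `MathematicalPhysics/QuantumLattice`, namespace `Literature.MathematicalPhysics.QuantumLattice`.

For the grand-canonical `t–t'` Hubbard Hamiltonian `K_L = H^{tt'}_L − μ N_L` on the fermionic torus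
`(ℤ/Lℤ)²` (`hubbardTorusTT' L t t' U`, `totalNumber`; `L ≥ 3`), this file instantiates the abstract Markov
pressure bound `torus_log_partitionFn_le_of_certificate` (`TorusMarkovPressureBound.lean`):

* `K_L` is Hermitian, even and translation invariant (`parityAut_eq_self_of_preservesSectors`, tree
  `relabel_translate_hubbardTorusTT'`);
* **the local energy representative**: for every translation-invariant density matrix `ρ` on the torus
  and every window `Λ` containing a translate `z + [-1,1]²` of the support of the mean-energy observable
  `E_Φ` (`meanEnergyObs`) and a site `x`,
  `tr(ρ H^{tt'}_L) = L² · tr(ρ_Λ · Γ(τ_z E_Φ))` and `tr(ρ N_L) = L² · tr(ρ_Λ (n_{x↑} + n_{x↓}))`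
  (`trace_mul_hubbardTorusTT'_eq`, `trace_mul_totalNumber_eq`; the translates of `E_Φ` sum to `H^{tt'}_L`,
  tree `sum_relabel_translate_hubbardTTPrime_meanEnergyObs`), and translation-related local observables
  have equal expectation (`trace_fermionPartialTrace_mul_translate_eq` — the "annihilator" of the
  certificate);
* **the theorem** `hubbardTTPrime_log_partitionFn_le_of_certificate`: for a window `Λ ⊆ [0,ℓ)²`
  (`3 ≤ L`, `ℓ ≤ L`) with lexicographically largest site `a`, a Hermitian `G ∈ 𝔄_Λ` of zero expectation
  in the window state of the Gibbs density (discharged with the previous item), a dual variable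
  `L_B ∈ 𝔄_{Λ∖a}` and a real `c` passing the matrix certificate for
  `H = β (Γ(τ_z E_Φ) − μ (n_{x↑}+n_{x↓}) + G)`,
  `log Z_β(K_L) ≤ L² · c + (L² − (L+1−ℓ)²) · (log 4 − c − β e)` (`e` = the window energy per site).

This is the finite-volume, kernel-checked form of the "C1" certificate of the `hubbard-thermal` free-energy
programme (Markov-entropy-decomposition upper bound on the pressure with a rational dual,
[cite: PoulinHastings2011, eqs. (3)–(8)], for lattice fermions). Everything is PROVED; no definition, no
named fact.
-/

noncomputable section

namespace Literature.MathematicalPhysics.QuantumLattice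

open Matrix Finset HubbardWave0 Literature.Probability.LatticeModels
open scoped ComplexOrder
open Literature.InformationTheory.Entropy (vonNeumannEntropy)

/-! ### §1. Parity of sector-preserving operators -/

section Parity

variable {Λ : Type*} [LinearOrder Λ] [Fintype Λ]

/-- `P² = 1` on scalars: `(-1)^n · (-1)^n = 1`. [folklore] -/
private theorem neg_one_pow_mul_self (n : ℕ) : ((-1 : ℂ) ^ n) * ((-1 : ℂ) ^ n) = 1 := by
  rw [← mul_pow]
  norm_num

/-- **An operator preserving the `(N↑, N↓)` sectors is even** (`Θ M = M`): its matrix entries only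
connect configurations of equal particle number. [cite: ArakiMoriya2003, §4.1 Def. 4.2] -/
theorem parityAut_eq_self_of_preservesSectors {M : Matrix (Finset (Orb Λ)) (Finset (Orb Λ)) ℂ}
    (hM : PreservesSectors M) : parityAut M = M := by
  ext s s'
  rw [parityAut_apply, parityOp, Matrix.mul_diagonal, Matrix.diagonal_mul]
  by_cases h : M s s' = 0
  · rw [h, mul_zero, zero_mul]
  · obtain ⟨hu, hd⟩ := hM s s' h
    rw [card_eq_upPart_add_downPart s, card_eq_upPart_add_downPart s', hu, hd,
      mul_comm ((-1 : ℂ) ^ _) (M s s'), mul_assoc, neg_one_pow_mul_self, mul_one]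

/-- **The particle number is even**: `Θ N = N`. [cite: ArakiMoriya2003, §4.1 Def. 4.2] -/
theorem parityAut_totalNumber :
    parityAut (totalNumber : Matrix (Finset (Orb Λ)) (Finset (Orb Λ)) ℂ) = totalNumber := by
  rw [parityAut_apply, totalNumber_eq_diagonal_card, parityOp, Matrix.diagonal_mul_diagonal,
    Matrix.diagonal_mul_diagonal]
  congr 1
  funext s
  rw [mul_comm ((-1 : ℂ) ^ _) (s.card : ℂ), mul_assoc, neg_one_pow_mul_self, mul_one]

end Parity

/-! ### §2. Translation-invariant torus states: expectations of translates -/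

section Invariant

variable {ι : Type*} [LinearOrder ι] [Fintype ι]

/-- **Invariance of expectations**: if `Γ(e) ρ Γ(e)⁻¹ = ρ` then `tr(ρ · Γ(e) X Γ(e)⁻¹) = tr(ρ X)`.
[cite: ArakiMoriya2003, §4.1 Def. 4.5] -/
theorem trace_mul_relabel_of_invariant (e : ι ≃ ι) {ρ : Matrix (Finset ι) (Finset ι) ℂ}
    (hρ : relabel e ρ = ρ) (X : Matrix (Finset ι) (Finset ι) ℂ) :
    (ρ * relabel e X).trace = (ρ * X).trace := by
  have hsymm : (relabel e).symm ρ = ρ := by rw [AlgEquiv.symm_apply_eq]; exact hρ.symm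
  conv_lhs => rw [← (relabel e).apply_symm_apply ρ, ← map_mul, trace_relabel, hsymm]

end Invariant

section Torus

variable (L : ℕ) [NeZero L]

/-- (Local.) As in `TorusMarkovPressureBound.lean` / `HubbardAndersonClusterBound.lean`: equality of torus
orbitals is decided through the linear order. [folklore] -/
local instance (priority := high) instDecidableEqOrbFermionTorusMarkovH :
    DecidableEq (Orb (FermionTorus 2 L)) :=
  LinearOrder.toDecidableEq

/-- `|(ℤ/Lℤ)²| = L²`. [folklore] -/
private theorem card_torusSite_sq' : Fintype.card (TorusSite 2 L) = L ^ 2 := by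
  simp [ZMod.card, Fintype.card_fin]

/-- **The expectation of a translation sum** in a translation-invariant torus state is `L²` times the
expectation of one term. [cite: BratteliRobinsonI1987, §4.3.1] -/
theorem trace_mul_sum_relabel_translate
    {ρ : Matrix (Finset (Orb (FermionTorus 2 L))) (Finset (Orb (FermionTorus 2 L))) ℂ}
    (hTI : ∀ w : TorusSite 2 L, relabel (Orb.translate w) ρ = ρ)
    (X : Matrix (Finset (Orb (FermionTorus 2 L))) (Finset (Orb (FermionTorus 2 L))) ℂ) :
    (ρ * ∑ v : TorusSite 2 L, relabel (Orb.translate v) X).trace = ((L : ℂ) ^ 2) * (ρ * X).trace := by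
  rw [Matrix.mul_sum, Matrix.trace_sum]
  simp_rw [trace_mul_relabel_of_invariant (Orb.translate _) (hTI _) X]
  rw [Finset.sum_const, Finset.card_univ, card_torusSite_sq', nsmul_eq_mul, Nat.cast_pow]

/-- **Translation-related local observables have equal expectation** ("annihilator" of the certificate):
for a translation-invariant torus state `ρ`, a region `Ω` fitting into the torus, `A ∈ 𝔄_{Λ₁}` with
`Λ₁ ⊆ Ω` and `Λ₁ + z ⊆ Ω`: `tr(ρ_Ω · Γ(incl)(Γ(τ_z) A)) = tr(ρ_Ω · Γ(incl) A)`.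
[cite: ArakiMoriya2003, §4.1 Def. 4.3 and Def. 4.5] -/
theorem trace_fermionPartialTrace_mul_translate_eq
    {ρ : Matrix (Finset (Orb (FermionTorus 2 L))) (Finset (Orb (FermionTorus 2 L))) ℂ}
    (hTI : ∀ w : TorusSite 2 L, relabel (Orb.translate w) ρ = ρ)
    {Ω Λ₁ : Finset (Site 2)} (hΩ : Set.InjOn (Torus.proj (d := 2) L) ↑Ω) (h₁ : Λ₁ ⊆ Ω) (z : Site 2)
    (hz : shiftSet z Λ₁ ⊆ Ω) (A : FermionOp Λ₁) :
    (fermionPartialTrace (PolySite.toTorusEmb L hΩ) ρ *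
        fermionEmbed (PolySite.incl hz) (fermionEmbed (PolySite.shiftEmb z Λ₁) A)).trace =
      (fermionPartialTrace (PolySite.toTorusEmb L hΩ) ρ * fermionEmbed (PolySite.incl h₁) A).trace := by
  have hΛ₁ : Set.InjOn (Torus.proj (d := 2) L) ↑Λ₁ := hΩ.mono (Finset.coe_subset.2 h₁)
  have e1 : (PolySite.incl h₁).trans (PolySite.toTorusEmb L hΩ) = PolySite.toTorusEmb L hΛ₁ :=
    DFunLike.ext _ _ fun _ => rfl
  rw [Matrix.trace_mul_comm, trace_mul_fermionPartialTrace, ← relabel_translate_proj_fermionEmbed L hΩ hΛ₁ z hz A,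
    Matrix.trace_mul_comm, trace_mul_relabel_of_invariant _ (hTI _),
    Matrix.trace_mul_comm (fermionPartialTrace _ ρ), trace_mul_fermionPartialTrace, fermionEmbed_fermionEmbed, e1,
    Matrix.trace_mul_comm]

/-! ### §3. The energy and particle-number identities for the `t–t'` Hubbard torus -/

/-- **The energy per site is the window expectation of (a translate of) `E_Φ`**: for `L ≥ 3`, a
translation-invariant torus state `ρ`, a window `Ω` fitting into the torus and containing
`z + [-1,1]²`: `tr(ρ H^{tt'}_L) = L² · tr(ρ_Ω · Γ(incl)(Γ(τ_z) E_Φ))`.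
[cite: BratteliRobinsonII1997, §6.2.4] -/
theorem trace_mul_hubbardTorusTT'_eq (t t' U : ℝ) (hL : 3 ≤ L)
    {ρ : Matrix (Finset (Orb (FermionTorus 2 L))) (Finset (Orb (FermionTorus 2 L))) ℂ}
    (hTI : ∀ w : TorusSite 2 L, relabel (Orb.translate w) ρ = ρ)
    {Ω : Finset (Site 2)} (hΩ : Set.InjOn (Torus.proj (d := 2) L) ↑Ω) (z : Site 2)
    (hz : shiftSet z (thicken ({0} : Finset (Site 2)) 1) ⊆ Ω) :
    (ρ * hubbardTorusTT' L t t' U).trace =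
      ((L : ℂ) ^ 2) * (fermionPartialTrace (PolySite.toTorusEmb L hΩ) ρ *
        fermionEmbed (PolySite.incl hz) (fermionEmbed (PolySite.shiftEmb z (thicken ({0} : Finset (Site 2)) 1))
          ((hubbardTTPrimeFermionInteraction t t' U).meanEnergyObs 1))).trace := by
  rw [← sum_relabel_translate_hubbardTTPrime_meanEnergyObs t' t U hL, trace_mul_sum_relabel_translate L hTI]
  congr 1
  rw [← trace_mul_relabel_of_invariant (Orb.translate (Torus.proj L z)) (hTI _),
    relabel_translate_proj_fermionEmbed L hΩ (injOn_proj_thicken_one hL) z hz, Matrix.trace_mul_comm,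
    ← trace_mul_fermionPartialTrace, Matrix.trace_mul_comm]

omit [NeZero L] in
/-- `|FermionTorus 2 L| = L²`. [folklore] -/
private theorem card_fermionTorus_sq' : Fintype.card (FermionTorus 2 L) = L ^ 2 := by
  rw [Fintype.card_lex, Fintype.card_fun, Fintype.card_fin, Fintype.card_fin]

/-- **The density is the window expectation of `n_x`**: for a translation-invariant torus state and a
window `Ω ∋ x` fitting into the torus, `tr(ρ N_L) = L² · tr(ρ_Ω (n_{x↑} + n_{x↓}))`.
[cite: BratteliRobinsonI1987, §4.3.1] -/
theorem trace_mul_totalNumber_eq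
    {ρ : Matrix (Finset (Orb (FermionTorus 2 L))) (Finset (Orb (FermionTorus 2 L))) ℂ}
    (hTI : ∀ w : TorusSite 2 L, relabel (Orb.translate w) ρ = ρ)
    {Ω : Finset (Site 2)} (hΩ : Set.InjOn (Torus.proj (d := 2) L) ↑Ω) {x : Site 2} (hx : x ∈ Ω) :
    (ρ * totalNumber).trace =
      ((L : ℂ) ^ 2) * (fermionPartialTrace (PolySite.toTorusEmb L hΩ) ρ * (nAt x hx 0 + nAt x hx 1)).trace := by
  set x₀ : FermionTorus 2 L := PolySite.toTorusEmb L hΩ (PolySite.pt x hx) with hx₀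
  -- every `n_{yσ}` is a translate of `n_{x₀σ}`
  have hn : ∀ (y : FermionTorus 2 L) (σ : Fin 2), (ρ * numberOp y σ).trace = (ρ * numberOp x₀ σ).trace := by
    intro y σ
    have hy : relabel (Orb.translate (FermionTorus.toTorusSite y - FermionTorus.toTorusSite x₀)) (numberOp x₀ σ) =
        numberOp y σ := by
      simp only [Orb.translate, relabel_mapEquiv_numberOp, FermionTorus.ofTorusEquiv_apply, Equiv.coe_addRight,
        add_sub_cancel, FermionTorus.ofTorusSite_toTorusSite]
    rw [← hy, trace_mul_relabel_of_invariant _ (hTI _)]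
  rw [totalNumber, Matrix.mul_sum, Matrix.trace_sum]
  simp_rw [Matrix.mul_sum, Matrix.trace_sum, hn]
  rw [Finset.sum_const, Finset.card_univ, card_fermionTorus_sq', nsmul_eq_mul, Nat.cast_pow, Fin.sum_univ_two]
  congr 1
  simp only [nAt]
  rw [Matrix.mul_add, Matrix.trace_add, Matrix.trace_mul_comm _ (numberOp (PolySite.pt x hx) 0),
    Matrix.trace_mul_comm _ (numberOp (PolySite.pt x hx) 1), trace_mul_fermionPartialTrace,
    trace_mul_fermionPartialTrace, fermionEmbed_numberOp, fermionEmbed_numberOp, ← hx₀, Matrix.trace_mul_comm ρ,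
    Matrix.trace_mul_comm ρ]

/-! ### §4. The certified upper bound on the grand-canonical pressure -/

/-- **Certified Markov upper bound on the grand-canonical pressure of the `t–t'` Hubbard torus.**
Let `L ≥ 3`, `β, μ` real, `K_L = H^{tt'}_L − μ N_L`, `ρ_β = e^{−βK_L}/Z` its Gibbs density. Let
`Λ ⊆ [0, ℓ)²` (`ℓ ≤ L`) be a window with lexicographically largest site `a`, containing a translate
`z + [-1,1]²` and a site `x`; let `ρ_Λ = tr_{𝕋→Λ} ρ_β` and
`h = Γ(incl)(Γ(τ_z) E_Φ) − μ (n_{x↑} + n_{x↓}) + G` with `G ∈ 𝔄_Λ` Hermitian of zero expectation in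
`ρ_Λ` (an "annihilator" combination, `trace_fermionPartialTrace_mul_translate_eq`). If `(L_B, c)` passes
the certificate `e^c · exp(L_B) − tr_{Λ→Λ∖a} exp(−β h + Γ L_B) ⪰ 0`, then
`log Z_β(K_L) ≤ L² · c + (L² − (L+1−ℓ)²) · (log 4 − c − β · Re tr(ρ_Λ h))`.
[cite: PoulinHastings2011, eqs. (3)–(8)] -/
theorem hubbardTTPrime_log_partitionFn_le_of_certificate (t t' U μ β : ℝ) (hL : 3 ≤ L)
    {Λ : Finset (Site 2)} {a : Site 2} (ha : a ∈ Λ) (hmax : ∀ y ∈ Λ, toLex y ≤ toLex a)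
    {ℓ : ℕ} (hΛ : Λ ⊆ halfOpenBox 2 ℓ) (hℓL : ℓ ≤ L)
    {z : Site 2} (hz : shiftSet z (thicken ({0} : Finset (Site 2)) 1) ⊆ Λ) {x : Site 2} (hx : x ∈ Λ)
    {G : FermionOp Λ} (hG : G.IsHermitian)
    (hG0 : (fermionPartialTrace (PolySite.toTorusEmb L (injOn_proj_of_subset_halfOpenBox' hΛ hℓL))
      ((partitionFn β (hubbardTorusTT' L t t' U - (μ : ℂ) • totalNumber))⁻¹ •
        gibbsWeight β (hubbardTorusTT' L t t' U - (μ : ℂ) • totalNumber)) * G).trace = 0)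
    {LB : FermionOp (Λ.erase a)} (hLB : LB.IsHermitian) {c : ℝ}
    (hcert : ((Real.exp c : ℂ) • cfc Real.exp LB -
      fermionPartialTrace (PolySite.incl (Finset.erase_subset a Λ))
        (cfc Real.exp (-((β : ℂ) •
            (fermionEmbed (PolySite.incl hz) (fermionEmbed (PolySite.shiftEmb z (thicken ({0} : Finset (Site 2)) 1))
                ((hubbardTTPrimeFermionInteraction t t' U).meanEnergyObs 1))
              - (μ : ℂ) • (nAt x hx 0 + nAt x hx 1) + G)) +
          fermionEmbed (PolySite.incl (Finset.erase_subset a Λ)) LB))).PosSemidef) :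
    Real.log (partitionFn β (hubbardTorusTT' L t t' U - (μ : ℂ) • totalNumber)).re ≤
      ((L : ℝ) ^ 2) * c +
        (((L ^ 2 : ℕ) : ℝ) - (((L + 1 - ℓ) ^ 2 : ℕ) : ℝ)) *
          (Real.log 4 - c - β *
            (fermionPartialTrace (PolySite.toTorusEmb L (injOn_proj_of_subset_halfOpenBox' hΛ hℓL))
                ((partitionFn β (hubbardTorusTT' L t t' U - (μ : ℂ) • totalNumber))⁻¹ •
                  gibbsWeight β (hubbardTorusTT' L t t' U - (μ : ℂ) • totalNumber)) *
              (fermionEmbed (PolySite.incl hz) (fermionEmbed (PolySite.shiftEmb z (thicken ({0} : Finset (Site 2)) 1))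
                  ((hubbardTTPrimeFermionInteraction t t' U).meanEnergyObs 1))
                - (μ : ℂ) • (nAt x hx 0 + nAt x hx 1) + G)).trace.re) := by
  set K : Matrix (Finset (Orb (FermionTorus 2 L))) (Finset (Orb (FermionTorus 2 L))) ℂ :=
    hubbardTorusTT' L t t' U - (μ : ℂ) • totalNumber with hK
  set EΦ : FermionOp Λ := fermionEmbed (PolySite.incl hz)
    (fermionEmbed (PolySite.shiftEmb z (thicken ({0} : Finset (Site 2)) 1))
      ((hubbardTTPrimeFermionInteraction t t' U).meanEnergyObs 1)) with hEΦ
  set h : FermionOp Λ := EΦ - (μ : ℂ) • (nAt x hx 0 + nAt x hx 1) + G with hh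
  -- `K` is Hermitian, even and translation invariant
  have hKherm : K.IsHermitian := by
    rw [hK]
    refine (hubbardTorusTT'_isHermitian L t t' U).sub ?_
    change ((μ : ℂ) • totalNumber)ᴴ = (μ : ℂ) • totalNumber
    have hN : (totalNumber : Matrix (Finset (Orb (FermionTorus 2 L))) (Finset (Orb (FermionTorus 2 L))) ℂ)ᴴ =
        totalNumber := by
      rw [totalNumber_eq_diagonal_card, Matrix.diagonal_conjTranspose]
      congr 1
      funext s
      simp
    rw [Matrix.conjTranspose_smul, Complex.star_def, Complex.conj_ofReal, hN]
  have hHs : PreservesSectors (hubbardTorusTT' L t t' U) :=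
    LiebTwoHoppings.preservesSectors_hamiltonian₂ (fermionTorusGraph 2 L) (fermionTorusDiagGraph L) t t' U
  have hKev : parityAut K = K := by
    rw [hK, map_sub, map_smul, parityAut_totalNumber, parityAut_eq_self_of_preservesSectors hHs]
  have hKTI : ∀ w : TorusSite 2 L, relabel (Orb.translate w) K = K := by
    intro w
    rw [hK, relabel_sub, relabel_smul, relabel_translate_hubbardTorusTT', Orb.translate, relabel_mapEquiv_totalNumber]
  -- the window energy representative
  have hΩ := injOn_proj_of_subset_halfOpenBox' hΛ hℓL
  set ρ := (partitionFn β K)⁻¹ • gibbsWeight β K with hρdef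
  have hρTI : ∀ w : TorusSite 2 L, relabel (Orb.translate w) ρ = ρ := relabel_translate_gibbsDensity L hKTI β
  have hhherm : h.IsHermitian := by
    rw [hh, hEΦ]
    refine Matrix.IsHermitian.add (Matrix.IsHermitian.sub ?_ ?_) hG
    · have hEherm : ((hubbardTTPrimeFermionInteraction t t' U).meanEnergyObs 1).IsHermitian := by
        unfold FermionInteraction.meanEnergyObs Matrix.IsHermitian
        rw [Matrix.conjTranspose_sum]
        refine Finset.sum_congr rfl fun X _ => ?_
        rw [Matrix.conjTranspose_smul, ← fermionEmbed_conjTranspose,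
          ((hubbardTTPrimeFermionInteraction_isHermitian t t' U) X.1).eq]
        congr 1
        rw [Complex.star_def, map_inv₀, map_natCast]
      change (fermionEmbed _ (fermionEmbed _ _))ᴴ = _
      rw [← fermionEmbed_conjTranspose, ← fermionEmbed_conjTranspose, hEherm.eq]
    · change ((μ : ℂ) • (nAt x hx 0 + nAt x hx 1))ᴴ = _
      have hn : ∀ σ : Fin 2, (nAt x hx σ : FermionOp Λ)ᴴ = nAt x hx σ := fun σ => by
        change (creation _ * annihilation _)ᴴ = creation _ * annihilation _
        rw [Matrix.conjTranspose_mul, creation, Matrix.conjTranspose_conjTranspose]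
      rw [Matrix.conjTranspose_smul, Complex.star_def, Complex.conj_ofReal, Matrix.conjTranspose_add, hn, hn]
  have hKh : (ρ * K).trace.re =
      ((L : ℝ) ^ 2) * (fermionPartialTrace (PolySite.toTorusEmb L hΩ) ρ * h).trace.re := by
    have hE := trace_mul_hubbardTorusTT'_eq L t t' U hL hρTI hΩ z hz
    have hN := trace_mul_totalNumber_eq L hρTI hΩ hx
    have : (ρ * K).trace = ((L : ℂ) ^ 2) * (fermionPartialTrace (PolySite.toTorusEmb L hΩ) ρ * h).trace := by
      rw [hK, Matrix.mul_sub, Matrix.trace_sub, Matrix.mul_smul, Matrix.trace_smul, hE, hN, hh, hEΦ]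
      simp only [Matrix.mul_add, Matrix.mul_sub, Matrix.mul_smul, Matrix.trace_add, Matrix.trace_sub, Matrix.trace_smul,
        hG0, smul_eq_mul]
      ring
    rw [this, Complex.mul_re, ← Complex.ofReal_natCast, ← Complex.ofReal_pow, Complex.ofReal_re, Complex.ofReal_im,
      zero_mul, sub_zero]
  have key := torus_log_partitionFn_le_of_certificate L hKherm hKev hKTI β ha hmax hΛ hℓL hhherm hKh hLB hcert
  exact key

end Torus

end Literature.MathematicalPhysics.QuantumLattice

end
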